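import Summits.ResolutionOfSingularities.ResolutionOfSingularities.Theorems.WeightedInvariantIota3JSigmaDominanceSecondMember
import Summits.ResolutionOfSingularities.ResolutionOfSingularities.Theorems.WeightedInvariantIota3JSigmaDominanceGeneric
import Summits.ResolutionOfSingularities.ResolutionOfSingularities.Theorems.WeightedInvariantIota3FlagTools
import Summits.ResolutionOfSingularities.ResolutionOfSingularities.Theorems.WeightedInvariantIota3TwoFlagCompletion
import Summits.ResolutionOfSingularities.ResolutionOfSingularities.Theorems.WeightedInvariantJOpenPresentationCrossing
import Mathlib.LinearAlgebra.DFinsupp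
import Literature.AlgebraicGeometry.Resolution.WeightedInitialForms
import HarnessLib

/-!
# Dominance word, RATIO-ONE REGIME `r₁ = r₂ = r > q` (memo (6b) of res-D-brk-1's O70B-JCAN-PLAN), PART 1 — PRELIMINARIES:
# ceilings, `F ≤ 𝔪ᵏ`, the weighted valuation on products/powers, `c·wʲ ∉ (y) + 𝔪^{j+1}`, and the Φ-side bookkeeping
# (door `HypersurfaceCentreConstruction`, stmt-ResolutionOfSingularities-19897; P3 rung clause h8 ⟸ (σ-pres)₃ ⟸ the ONE dominance word
# `TwoFlagDominanceAtLevelLE3Body p`, regime `a = b`)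

Topic: `Summits/ResolutionOfSingularities/ResolutionOfSingularities/Theorems`. Helper for the door item `HypersurfaceCentreConstruction`
(stmt-ResolutionOfSingularities-19897, route `WeightedInvariant`), line `local-engine`, def-free.  The dominance word
`Iota3.TwoFlagDominanceAtLevelAt f` (…Iota3DominanceWordsDefs) in the regime `a = b` (maximal reached ratio `r₁/r₂ = 1`, so the triple is
`(q; r, r)`) asks: for two two-flags `Φ = (g₁, g₂)`, `Φ' = (g₁', g₂')` both carrying `f` to level `rν` of their `(q; r, r)`-filtrations,
`g₁', g₂' ∈ F_Φ(r) = (g₁, g₂) + 𝔪^⌈r/q⌉`.  The landed parts of the word treat `r₂ = q` (PART 1, …JSigmaDominanceGeneric) and `r₂ < r₁`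
((E1), …JSigmaDominanceSecondMember); the ratio-one regime `r₁ = r₂ = r > q` was the memo's §6b «notes for the next session», with the
sub-case «the common direction divides the tangent form» left OPEN there.  THIS FILE proves the core of §6b with NO such proviso:

* `Iota3.flagContactFiltration_le_pow_of_lt` — `F^{(q;r,r)}_{(g₁,g₂)}(n) ≤ 𝔪ᵏ` whenever `r(k − 1) < n` (`q ≤ r`);
* `Iota3.not_mem_span_sup_pow_of_isTwoFlag` — for a two-flag `(y, w)` of a regular local ring of dimension `3` and a unit `c`:
  `c·wʲ ∉ (y) + 𝔪^{j+1}` (weighted quasi-regularity with weights `(1, 1, j+1)`);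
* `Iota3.mul_not_mem_weightedIdealW_succ`, `Iota3.pow_mem_not_mem_weightedIdealW` — the weighted order of a regular system is a valuation
  (products and powers; `inForm_mul` / `inForm_eq_zero_iff` of the Literature);
* `Iota3.exists_unit_coeff_of_reaches_ratio_one` — the Φ-side bookkeeping: if `f ∈ F_{(y,w)}(rν)`, `q < r`, and `f ∉ (w^ν) + 𝔪^{ν+1}`, then
  for some `j₀ < ν` and a UNIT `c`, `f − c·y^{ν−j₀}w^{j₀}` lies in `y^{ν−j₀}·P ⊔ (y^{ν−j₀+1}) ⊔ LOW`, with `P = Σ_{β<j₀} (w^β)𝔪^⌈r(j₀−β)/q⌉`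
  and `LOW` the pieces `(y^α w^β)𝔪^⌈r(ν−α−β)/q⌉`, `α < ν − j₀`;
The core lemma `Iota3.mem_weight_of_reaches_ratio_one_of_common` (two reaching flags with a common second member dominate each other,
including the memo's «open sub-case») is PART 2 (…Iota3RatioOneDominance), which imports this file.

[OURS · L1 W4.3 · (o70-b)/(Δ12) §6b]  Replaces the role of NO printed item; NOT a statement of the manuscript [claim: Hironaka2017,
status: under-review]. AI work, weaker than expert review.  Pure commutative algebra; no named facts; no definition.

## References

* V. Cossart, U. Jannsen, S. Saito, *Desingularization: invariants and strategy*, LNM 2270 (2020), Def. 8.2, Lemma 8.3. [CossartJannsenSaito2020]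
* H. Hironaka, *Characteristic polyhedra of singularities*, J. Math. Kyoto Univ. 7 (1967), §1. [Hironaka1967]
* res-D-brk-1, `D/res-D-brk-1/O70B-JCAN-PLAN.md` §6b (OURS, AI analysis, 2026-08-27).
-/

noncomputable section

set_option linter.dupNamespace false -- mandated namespace `Summit.<Summit>.<Problem>` of this single-conjunct summit

open IsLocalRing Literature.AlgebraicGeometry.Resolution
open Summit.ResolutionOfSingularities.ResolutionOfSingularities.Theorems

namespace Summit.ResolutionOfSingularities.ResolutionOfSingularities.Cruxes.HypersurfaceCentreConstruction.LocalEngine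

namespace Iota3

/-! ## §1 Ideal inequalities for the `(q; r, r)`-filtration (any local ring) -/

section LocalRing

variable {S : Type} [CommRing S] [IsLocalRing S]

/-- `F^{(q;r,r)}_{(g₁,g₂)}(n) ≤ 𝔪ᵏ` as soon as `r(k−1) < n` (spelled `r·k < n + r`), for `g₁, g₂ ∈ 𝔪` and `0 < q ≤ r`: a piece
`(g₁^α g₂^β)𝔪ᵉ` has `α + β + e ≥ k`. [folklore] -/
theorem flagContactFiltration_le_pow_of_lt {g₁ g₂ : S} (hg₁ : g₁ ∈ maximalIdeal S) (hg₂ : g₂ ∈ maximalIdeal S)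
    {q r n k : ℕ} (hq : 0 < q) (hqr : q ≤ r) (hk : r * k < n + r) :
    flagContactFiltration g₁ g₂ q r r n ≤ maximalIdeal S ^ k := by
  rw [flagContactFiltration_def]
  refine iSup_le fun α => iSup_le fun β => (flagPiece_le_pow hg₁ hg₂ α β _).trans (Ideal.pow_le_pow_right ?_)
  have hce : n - r * α - r * β ≤ q * ((n - r * α - r * β + q - 1) / q) := by
    have h := Nat.lt_div_mul_add (a := n - r * α - r * β + q - 1) hq
    have h' := mul_comm ((n - r * α - r * β + q - 1) / q) q
    omega
  have h2 : q * ((n - r * α - r * β + q - 1) / q) ≤ r * ((n - r * α - r * β + q - 1) / q) :=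
    Nat.mul_le_mul_right _ hqr
  have h4 : r * k < r * (α + β + (n - r * α - r * β + q - 1) / q + 1) := by
    have : r * (α + β + (n - r * α - r * β + q - 1) / q + 1) =
        r * α + r * β + r * ((n - r * α - r * β + q - 1) / q) + r := by ring
    rw [this]
    omega
  have := Nat.lt_of_mul_lt_mul_left h4
  omega

/-- Level `1` of the filtration is inside `𝔪` (`0 < q ≤ r`). [folklore] -/
theorem flagContactFiltration_one_le {g₁ g₂ : S} (hg₁ : g₁ ∈ maximalIdeal S) (hg₂ : g₂ ∈ maximalIdeal S)
    {q r : ℕ} (hq : 0 < q) (hqr : q ≤ r) : flagContactFiltration g₁ g₂ q r r 1 ≤ maximalIdeal S := by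
  have h := flagContactFiltration_le_pow_of_lt hg₁ hg₂ (n := 1) (k := 1) hq hqr (by omega)
  rwa [pow_one] at h

end LocalRing

/-! ## §2 The weighted order of a regular system of parameters is a valuation (regular local, dimension `3`) -/

section Valuation

variable {R : Type} [CommRing R] [IsRegularLocalRing R]

/-- **Products**: `g ∈ F_a ∖ F_{a+1}`, `h ∈ F_b ∖ F_{b+1}` ⇒ `g·h ∉ F_{a+b+1}` (the graded ring of the weighted filtration of a regular
system `(c; w)` is a weighted polynomial ring over the residue field, a domain: `inForm_mul`, `inForm_eq_zero_iff`).
[cite: CossartJannsenSaito2020, Lemma 8.3] -/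
theorem mul_not_mem_weightedIdealW_succ (c : Fin 3 → R) (hgen : Ideal.span {c 0, c 1, c 2} = maximalIdeal R)
    (hdim : ringKrullDim R = 3) {w : Fin 3 → ℕ} (hw : ∀ i, 0 < w i) {g h : R} {a b : ℕ}
    (hg : g ∈ weightedIdealW c w a) (hg' : g ∉ weightedIdealW c w (a + 1))
    (hh : h ∈ weightedIdealW c w b) (hh' : h ∉ weightedIdealW c w (b + 1)) :
    g * h ∉ weightedIdealW c w (a + b + 1) := by
  have hmem : g * h ∈ weightedIdealW c w (a + b) := weightedIdealW_mul_le c w a b (Ideal.mul_mem_mul hg hh)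
  intro hbad
  have h0 : inForm c w (a + b) (g * h) = 0 := (inForm_eq_zero_iff c hgen hdim hw hmem).mpr hbad
  rw [inForm_mul c hgen hdim hw hg hh] at h0
  rcases mul_eq_zero.mp h0 with h1 | h1
  · exact hg' ((inForm_eq_zero_iff c hgen hdim hw hg).mp h1)
  · exact hh' ((inForm_eq_zero_iff c hgen hdim hw hh).mp h1)

/-- **Powers**: `g ∈ F_a ∖ F_{a+1}`, `1 ≤ k` ⇒ `g^k ∈ F_{ka} ∖ F_{ka+1}`. [cite: CossartJannsenSaito2020, Lemma 8.3] -/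
theorem pow_mem_not_mem_weightedIdealW (c : Fin 3 → R) (hgen : Ideal.span {c 0, c 1, c 2} = maximalIdeal R)
    (hdim : ringKrullDim R = 3) {w : Fin 3 → ℕ} (hw : ∀ i, 0 < w i) {g : R} {a : ℕ}
    (hg : g ∈ weightedIdealW c w a) (hg' : g ∉ weightedIdealW c w (a + 1)) {k : ℕ} (hk : 1 ≤ k) :
    g ^ k ∈ weightedIdealW c w (k * a) ∧ g ^ k ∉ weightedIdealW c w (k * a + 1) := by
  induction k, hk using Nat.le_induction with
  | base =>
    rw [pow_one, one_mul]
    exact ⟨hg, hg'⟩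
  | succ j hj ih =>
    obtain ⟨hmem, hne⟩ := ih
    refine ⟨?_, ?_⟩
    · rw [pow_succ, Nat.succ_mul]
      exact weightedIdealW_mul_le c w _ _ (Ideal.mul_mem_mul hmem hg)
    · rw [pow_succ, Nat.succ_mul]
      exact mul_not_mem_weightedIdealW_succ c hgen hdim hw hmem hne hg hg'

end Valuation

/-! ## §3 A two-flag power is not absorbed: `c·wʲ ∉ (y) + 𝔪^{j+1}` -/

section TwoFlag

variable {S : Type} [CommRing S] [IsRegularLocalRing S]

/-- **`c·wʲ ∉ (y) + 𝔪^{j+1}`** for a two-flag `(y, w)` of a regular local ring of dimension `3` and a unit `c`: weighted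
quasi-regularity of the completed system `(x, w, y)` with weights `(1, 1, j+1)`, under which `(y) + 𝔪^{j+1} ⊆ F_{j+1}` while
`w ∈ F_1 ∖ F_2`. [OURS · L1 W4.3 · (o70-b) §6b] -/
theorem not_mem_span_sup_pow_of_isTwoFlag (hdim : ringKrullDim S = (3 : ℕ)) {y w : S} (hyw : IsTwoFlag y w)
    {c : S} (hc : IsUnit c) (j : ℕ) : c * w ^ j ∉ Ideal.span {y} ⊔ maximalIdeal S ^ (j + 1) := by
  rcases Nat.eq_zero_or_pos j with rfl | hj
  · rw [pow_zero, mul_one, zero_add, pow_one]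
    intro h
    have hle : Ideal.span {y} ⊔ maximalIdeal S ≤ maximalIdeal S :=
      sup_le ((Ideal.span_singleton_le_iff_mem _).mpr hyw.1) le_rfl
    exact (IsLocalRing.mem_maximalIdeal _).mp (hle h) hc
  · obtain ⟨x, hx, -⟩ := exists_span_triple_of_isTwoFlag S hdim y w hyw
    have hdim' : ringKrullDim S = 3 := by rw [hdim]; rfl
    have h1 : (0 : ℕ) < 1 := Nat.one_pos
    have hw1 : ∀ i, 0 < (![1, 1, j + 1] : Fin 3 → ℕ) i := by
      intro i
      fin_cases i <;> simp
    have hgen : Ideal.span {(![x, w, y] : Fin 3 → S) 0, (![x, w, y] : Fin 3 → S) 1, (![x, w, y] : Fin 3 → S) 2} =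
        maximalIdeal S := by
      simpa using hx
    have hbridge : ∀ n, flagContactFiltration y w 1 (j + 1) 1 n = weightedIdealW ![x, w, y] ![1, 1, j + 1] n := fun n => by
      rw [flagContactFiltration_eq_weightedMonomialIdeal hx h1 le_rfl (by omega) n,
        CrossingPoint.weightedMonomialIdeal_eq_weightedIdealW]
    -- `w ∈ F₁(1) ∖ F₁(2)`
    have hwm : w ∈ flagContactFiltration y w 1 (j + 1) 1 1 := (self_mem_flagContactFiltration y w (j + 1) 1 h1).2
    have hwn : w ∉ flagContactFiltration y w 1 (j + 1) 1 2 := by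
      intro h
      have h' := flagContactFiltration_le_span_sup_pow (g₁ := y) hyw.2.1 h1 (j + 1) 2 h
      have h2 : (2 + 1 - 1) / 1 = 2 := by norm_num
      rw [h2] at h'
      obtain ⟨s, hs, m, hm, hsm⟩ := Submodule.mem_sup.mp h'
      obtain ⟨t, rfl⟩ := Ideal.mem_span_singleton'.mp hs
      have hmem : (-t) * y + 1 * w ∈ maximalIdeal S ^ 2 := by
        have : (-t) * y + 1 * w = m := by rw [← hsm]; ring
        rw [this]
        exact hm
      have := (hyw.2.2 (-t) 1 hmem).2
      exact (IsLocalRing.maximalIdeal.isMaximal S).ne_top (Ideal.eq_top_of_isUnit_mem _ this isUnit_one)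
    -- `(y) ⊔ 𝔪^{j+1} ≤ F₁(j+1)`
    have hle : Ideal.span {y} ⊔ maximalIdeal S ^ (j + 1) ≤ flagContactFiltration y w 1 (j + 1) 1 (j + 1) := by
      refine sup_le ((Ideal.span_singleton_le_iff_mem _).mpr (self_mem_flagContactFiltration y w (j + 1) 1 h1).1) ?_
      intro m hm
      exact mem_flagContactFiltration_of_mem_pow h1 hm (by omega)
    intro hbad
    have hval := mul_pow_not_mem_weightedIdealW ![x, w, y] hgen hdim' hw1 (g := w) (a := 1)
      (by rw [← hbridge]; exact hwm) (by rw [← hbridge]; exact hwn) hc hj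
    rw [mul_one, ← hbridge] at hval
    exact hval (hle hbad)

end TwoFlag

/-! ## §4 The Φ-side bookkeeping: a unit top coefficient off `w^ν`, and the split of the rest -/

section Bookkeeping

variable {S : Type} [CommRing S] [IsLocalRing S]

/-- `r·n − r·a − r·b = r·(n − a − b)` in `ℕ`. [folklore] -/
theorem mul_sub_sub_eq (r n a b : ℕ) : r * n - r * a - r * b = r * (n - a - b) := by
  rw [Nat.sub_sub, Nat.sub_sub, ← Nat.mul_add, Nat.mul_sub]

/-- The pieces `(y^α w^β)·𝔪^⌈r(ν−α−β)/q⌉` with `α + β < ν` lie in `𝔪^{ν+1}` when `q < r`. [folklore] -/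
theorem rest_le_pow_succ_of_lt {y w : S} (hy : y ∈ maximalIdeal S) (hw : w ∈ maximalIdeal S) {q r : ℕ} (hq : 0 < q)
    (hqr : q < r) (ν : ℕ) :
    (⨆ α, ⨆ β, ⨆ (_ : α + β < ν), Ideal.span {y ^ α * w ^ β} * maximalIdeal S ^ ((r * ν - r * α - r * β + q - 1) / q)) ≤
      maximalIdeal S ^ (ν + 1) := by
  refine iSup_le fun α => iSup_le fun β => iSup_le fun hαβ => (flagPiece_le_pow hy hw α β _).trans (Ideal.pow_le_pow_right ?_)
  have hce : r * ν - r * α - r * β ≤ q * ((r * ν - r * α - r * β + q - 1) / q) := by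
    have h := Nat.lt_div_mul_add (a := r * ν - r * α - r * β + q - 1) hq
    have h' := mul_comm ((r * ν - r * α - r * β + q - 1) / q) q
    omega
  rw [mul_sub_sub_eq] at hce ⊢
  set e := (r * (ν - α - β) + q - 1) / q
  have hprod : (q + 1) * (ν - α - β) ≤ r * (ν - α - β) := Nat.mul_le_mul_right _ hqr
  have hexp : (q + 1) * (ν - α - β) = q * (ν - α - β) + (ν - α - β) := by ring
  by_contra hlt
  have hem : e ≤ ν - α - β := by omega
  have := Nat.mul_le_mul_left q hem
  omega

/-- **Unit top coefficient.**  If `f ∈ F_{(y,w)}^{(q;r,r)}(rν)` with `q < r` and `f ∉ (w^ν) + 𝔪^{ν+1}`, then for some `j₀ < ν` and a unit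
`c`, `f − c·y^{ν−j₀} w^{j₀}` lies in `y^{ν−j₀}·P ⊔ (y^{ν−j₀+1}) ⊔ LOW` with `P = Σ_{β<j₀} (w^β)·𝔪^⌈r(j₀−β)/q⌉` and `LOW` the pieces
`(y^α w^β)·𝔪^⌈r(ν−α−β)/q⌉` with `α + β ≤ ν`, `α + j₀ < ν`. [OURS · L1 W4.3 · (o70-b) §6b] -/
theorem exists_unit_coeff_of_reaches_ratio_one {y w f : S} (hy : y ∈ maximalIdeal S) (hw : w ∈ maximalIdeal S)
    {q r ν : ℕ} (hq : 0 < q) (hqr : q < r) (hF : f ∈ flagContactFiltration y w q r r (r * ν))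
    (hNP : f ∉ Ideal.span {w ^ ν} ⊔ maximalIdeal S ^ (ν + 1)) :
    ∃ (j₀ : ℕ) (c : S), j₀ < ν ∧ IsUnit c ∧
      f - c * (y ^ (ν - j₀) * w ^ j₀) ∈
        Ideal.span {y ^ (ν - j₀)} *
            (⨆ β, ⨆ (_ : β < j₀), Ideal.span {w ^ β} * maximalIdeal S ^ ((r * (j₀ - β) + q - 1) / q)) ⊔
          Ideal.span {y ^ (ν - j₀ + 1)} ⊔
          (⨆ α, ⨆ β, ⨆ (_ : α + β ≤ ν), ⨆ (_ : α + j₀ < ν),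
            Ideal.span {y ^ α * w ^ β} * maximalIdeal S ^ ((r * ν - r * α - r * β + q - 1) / q)) := by
  classical
  -- Step A: top monomials ⊔ REST₀
  have hle : flagContactFiltration y w q r r (r * ν) ≤
      (⨆ j ∈ Finset.range (ν + 1), Ideal.span {y ^ (ν - j) * w ^ j}) ⊔
        (⨆ α, ⨆ β, ⨆ (_ : α + β < ν),
          Ideal.span {y ^ α * w ^ β} * maximalIdeal S ^ ((r * ν - r * α - r * β + q - 1) / q)) := by
    rw [flagContactFiltration_def]
    refine iSup_le fun α => iSup_le fun β => ?_
    rcases Nat.lt_or_ge (α + β) ν with hαβ | hαβ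
    · exact le_sup_of_le_right (le_iSup_of_le α (le_iSup_of_le β (le_iSup_of_le hαβ le_rfl)))
    · refine le_sup_of_le_left ?_
      have he : (r * ν - r * α - r * β + q - 1) / q = 0 := by
        rw [mul_sub_sub_eq]
        have : ν - α - β = 0 := by omega
        rw [this, mul_zero, zero_add]
        exact Nat.div_eq_of_lt (by omega)
      rw [he, pow_zero, mul_one]
      have hj : min β ν ∈ Finset.range (ν + 1) := Finset.mem_range.mpr (by omega)
      refine le_iSup_of_le (min β ν) (le_iSup_of_le hj ?_)
      rw [Ideal.span_singleton_le_span_singleton]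
      exact mul_dvd_mul (pow_dvd_pow y (by omega)) (pow_dvd_pow w (min_le_left β ν))
  obtain ⟨t, ht, ρ, hρ, htρ⟩ := Submodule.mem_sup.mp (hle hF)
  obtain ⟨μ, hμ⟩ := (Submodule.mem_iSup_finset_iff_exists_sum _ _).mp ht
  choose c hc using fun j => Ideal.mem_span_singleton'.mp (μ j).2
  -- Step B: some top coefficient off `w^ν` is a unit
  have hex : ∃ j₀, j₀ < ν ∧ IsUnit (c j₀) := by
    by_contra hno
    rw [not_exists] at hno
    refine hNP ?_
    rw [← htρ, ← hμ, Finset.sum_range_succ]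
    refine Ideal.add_mem _ (Ideal.add_mem _ ?_ ?_) ?_
    · refine Ideal.mem_sup_right (Ideal.sum_mem _ fun j hj => ?_)
      have hjν : j < ν := Finset.mem_range.mp hj
      have hcj : c j ∈ maximalIdeal S :=
        (IsLocalRing.mem_maximalIdeal _).mpr fun hu => hno j ⟨hjν, hu⟩
      rw [← hc j, pow_succ']
      refine Ideal.mul_mem_mul hcj ?_
      have : y ^ (ν - j) * w ^ j ∈ maximalIdeal S ^ (ν - j) * maximalIdeal S ^ j :=
        Ideal.mul_mem_mul (Ideal.pow_mem_pow hy _) (Ideal.pow_mem_pow hw _)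
      rwa [← pow_add, Nat.sub_add_cancel hjν.le] at this
    · refine Ideal.mem_sup_left ?_
      rw [← hc ν, Nat.sub_self, pow_zero, one_mul]
      exact Ideal.mul_mem_left _ _ (Ideal.mem_span_singleton_self _)
    · exact Ideal.mem_sup_right (rest_le_pow_succ_of_lt hy hw hq hqr ν hρ)
  obtain ⟨j₀, hj₀, hunit⟩ := hex
  refine ⟨j₀, c j₀, hj₀, hunit, ?_⟩
  -- Step C: the split of the rest
  have hsplit : f - c j₀ * (y ^ (ν - j₀) * w ^ j₀) = (∑ j ∈ (Finset.range (ν + 1)).erase j₀, (μ j : S)) + ρ := by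
    have hmem : j₀ ∈ Finset.range (ν + 1) := Finset.mem_range.mpr (by omega)
    rw [← htρ, ← hμ, ← Finset.add_sum_erase _ _ hmem, hc j₀]
    ring
  rw [hsplit]
  refine Ideal.add_mem _ (Ideal.sum_mem _ fun j hj => ?_) ?_
  · obtain ⟨hne, hj'⟩ := Finset.mem_erase.mp hj
    have hjν : j ≤ ν := Nat.lt_succ_iff.mp (Finset.mem_range.mp hj')
    rcases Nat.lt_or_gt_of_ne hne with hlt | hgt
    · -- `j < j₀`: a multiple of `y^{ν−j₀+1}`
      refine Ideal.mem_sup_left (Ideal.mem_sup_right ?_)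
      rw [← hc j]
      refine Ideal.mul_mem_left _ _ (Ideal.mem_span_singleton.mpr ?_)
      exact Dvd.dvd.mul_right (pow_dvd_pow y (by omega)) _
    · -- `j₀ < j`: a LOW piece with `α = ν − j`, `β = j`, exponent `0`
      refine Ideal.mem_sup_right ?_
      have he : (r * ν - r * (ν - j) - r * j + q - 1) / q = 0 := by
        rw [mul_sub_sub_eq]
        have : ν - (ν - j) - j = 0 := by omega
        rw [this, mul_zero, zero_add]
        exact Nat.div_eq_of_lt (by omega)
      have hpiece : Ideal.span {y ^ (ν - j) * w ^ j} ≤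
          ⨆ α, ⨆ β, ⨆ (_ : α + β ≤ ν), ⨆ (_ : α + j₀ < ν),
            Ideal.span {y ^ α * w ^ β} * maximalIdeal S ^ ((r * ν - r * α - r * β + q - 1) / q) :=
        le_iSup_of_le (ν - j) <| le_iSup_of_le j <| le_iSup_of_le (by omega) <| le_iSup_of_le (by omega) <| by
          rw [he, pow_zero, mul_one]
      rw [← hc j]
      exact hpiece (Ideal.mul_mem_left _ _ (Ideal.mem_span_singleton_self _))
  · refine SetLike.le_def.mp (iSup_le fun α => iSup_le fun β => iSup_le fun hαβ => ?_) hρ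
    rcases Nat.lt_or_ge (α + j₀) ν with hα | hα
    · exact le_sup_of_le_right
        (le_iSup_of_le α <| le_iSup_of_le β <| le_iSup_of_le hαβ.le <| le_iSup_of_le hα le_rfl)
    · rcases hα.eq_or_lt with hαeq | hαlt
      · -- `α = ν − j₀`, `β < j₀`: a `P`-piece
        have hαv : α = ν - j₀ := by omega
        have hβ : β < j₀ := by omega
        refine le_sup_of_le_left (le_sup_of_le_left ?_)
        have he : r * ν - r * α - r * β = r * (j₀ - β) := by
          rw [mul_sub_sub_eq]
          congr 1
          omega
        rw [he, hαv, ← Ideal.span_singleton_mul_span_singleton, mul_assoc]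
        exact Ideal.mul_mono_right (le_iSup_of_le β (le_iSup_of_le hβ le_rfl))
      · -- `α > ν − j₀`: a multiple of `y^{ν−j₀+1}`
        refine le_sup_of_le_left (le_sup_of_le_right (Ideal.mul_le_right.trans ?_))
        rw [Ideal.span_singleton_le_span_singleton]
        exact Dvd.dvd.mul_right (pow_dvd_pow y (by omega)) _

end Bookkeeping


end Iota3

end Summit.ResolutionOfSingularities.ResolutionOfSingularities.Cruxes.HypersurfaceCentreConstruction.LocalEngine

end
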